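import Summits.BirchSwinnertonDyer.Rank1Residual.Additive.TameBranchKatoDivisibilityRankOne
import Summits.BirchSwinnertonDyer.Rank1Residual.X2.AnalyticInvariants
import HarnessLib

/-!
# The tame-branch `p`-adic Gross–Zagier formula at an ADDITIVE potentially ORDINARY prime — TYPED
# (every defect `e ∈ {2,3,4,6}`, E-normalised currency), a THEOREM at analytic rank `0`, and its
# rank-one consumer: the LOWER half of BSD_p from print + one number (cell `bsd-addord`, seat
# `bsd-addord-gz`, memo PROOF-gz2)

HONEST FRAMING (cell `bsd-addord`, run/shared/lean/pub/bsd-addord/, FULL-BSD-RANK1 programme row B6 =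
O7-ord): this file TYPES the analytic input "p-adic Gross–Zagier on the tame branch" of the Iwasawa
route at an additive potentially-ordinary prime, in the tree's E-NORMALISED currency
(`IsTameBranchOf f p ε α B`, `Additive/TameBranchLower.lean`), uniformly in the tame defect
`e ∈ {2,3,4,6}`; proves it at analytic rank `0` (pure bookkeeping: `B(0) = α⁻¹[0]⁺_f`,
`[0]⁺_f·Ω⁺_f = L(E,1)`); and proves the rank-one CONSUMER: the typed input + ONE unit linear
coefficient + the period-index sign `ord_p ϖ ≤ 0` discharge the regulator certificate `hreg` of
`missingLowerBoundAt_of_tameBranchRatDvdAt_of_cert_of_regulatorCertificate`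
(`TameBranchKatoDivisibilityRankOne.lean`), so that the LOWER half `ord_p #Ш_an ≤ ord_p #Ш` on a
rank-one row follows from Delbourgo 2002 (A)(B)(C) + Gross–Zagier–Kolyvagin + the typed input.
The rank-ONE clause of the typed input is PROVED ON PAPER in the cell memo PROOF-gz2.md §3 (Disegni,
Compositio 153 (2017) Thm. B at `(E, 𝟙_K)` with RAMIFIED unit character; referee word pending) for
defect `3,4,6`, and in PROOF-gz.md §3 (Thm. 1, via `TameBranchOfTwistBranch[Mult|Odd]`) for defect `2`
and (M); it is NOT asserted here (a `def … : Prop`, nothing asserted; cell grammar). Nothing is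
booked; labels UNCHANGED. One definition, theorems; no named fact; no `sorry`.

## The statement (PROOF-gz2 Thm. 2 / Cor. 2′; PROOF-gz Cor. 2)

For `W = E` globally minimal, `p` a prime, `Dh` a `p`-adic height datum on `E(ℚ)`, and every tuple
`(f, ε, α, B, ϖ)` with `f` the newform of `W`, `ε` a Dirichlet character mod `p` of exact order
`tameDefect W p`, `α ∈ ℚ_p` a unit, `B ∈ ℚ_p⟦T⟧` satisfying `IsTameBranchOf f p ε α B` (bounded;
`B(0) = α⁻¹[0]⁺_f`; the wild interpolation rows in E's own symbols), `ϖ·Ω_E = Ω⁺_f`: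
`L^{(r)}(E,1)/r! = q·Ω_E·Reg_∞(E)` and `ϖ·[T^r]B·log_p(γ₀)^r = u·q·Reg_p(E,Dh)`, `u ∈ ℤ_p^×`,
`r = rank_ℤ E(ℚ)` (`γ₀ = 1 + p`). For the TRUE tuple (Delbourgo's `(ε, a)`, `B = c·(L_p^{an})^Δ`) and
`Dh = ⟨,⟩_{p,ℚ}` this is, at `r = 1`, PROOF-gz2 (T2): `[T¹]B·log_p γ₀ = ±a⁻¹·L′(E,1)·Reg_p/(Ω⁺_f·Reg_∞)`;
wrong tuples admit no bounded `B` (flag `Del02-ThmC-tuple-robustness` of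
`Lit/Delbourgo2002/RationalDivisibility.lean`), so the universal quantification says no more.

References: D. Delbourgo, Compositio Math. 113 (1998) Thm. 1, §2.5 BS-D(p) [Delbourgo1998]; D. Delbourgo,
J. Number Theory 95 (2002) p. 39, Thm. (A)–(C) [Delbourgo2002]; D. Disegni, Compositio Math. 153 (2017)
Def. 1.2.2, Thm. A, B [Disegni2017]; B. Mazur, J. Tate, J. Teitelbaum, Invent. Math. 84 (1986) §I.8,
§I.10, §I.13–14 [MazurTateTeitelbaum1986Invent]; R. L. Miller, LMS J. Comput. Math. 14 (2011) Def. 1.1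
[Miller2011LMS]; cell memos HOME/proof/PROOF-gz.md, PROOF-gz2.md.
-/

set_option autoImplicit false

noncomputable section

open scoped Classical MatrixGroups ModularForm NumberField

open CongruenceSubgroup IsDedekindDomain WeierstrassCurve NumberField
  Literature.NumberTheory.EllipticCurves
  Literature.NumberTheory.EllipticCurves.ModularForms
  Literature.NumberTheory.EllipticCurves.Rank1Residual
  Literature.NumberTheory.EllipticCurves.Rank1Residual.Typed
  Literature.NumberTheory.EllipticCurves.Delbourgo2002
  Summit.BirchSwinnertonDyer.Rank1Residual.AdditivePotMult
  Summit.BirchSwinnertonDyer.Rank1Residual.X1.MuLambda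
  Summit.BirchSwinnertonDyer.Rank1Residual.X1.RankOneParitySqueeze
  Summit.BirchSwinnertonDyer.Rank1Residual.X11a.LambdaNorm

namespace Summit.BirchSwinnertonDyer.Rank1Residual.Additive

/-! ### §0 The typed analytic input: `p`-adic Gross–Zagier on the tame branch (E-normalised) -/

/-- **TYPED INPUT — `p`-adic Gross–Zagier on the TAME branch at an additive potentially ORDINARY
prime (every defect; E-normalised currency; nothing asserted).** For `W = E`, the prime `p` and a
`p`-adic height datum `Dh` on `E(ℚ)`: for every newform `f` of `W`, every Dirichlet character `ε`
mod `p` of exact order `tameDefect W p`, every unit `α ∈ ℚ_p`, every `B ∈ ℚ_p⟦T⟧` with the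
E-normalised tame-branch package `IsTameBranchOf f p ε α B`, and every `ϖ ∈ ℚ` with `ϖ·Ω_E = Ω⁺_f`:
writing `r = rank_ℤ E(ℚ)`, `L^{(r)}(E,1)/r! = q·Ω_E·Reg_∞(E)` for a rational `q` and
`ϖ·[T^r]B·log_p(γ₀)^r = u·q·Reg_p(E,Dh)` for a unit `u ∈ ℤ_p^×`. Rank `0`: a THEOREM (§1). Rank `1`:
PROVED ON PAPER for the true tuple and `Dh = ⟨,⟩_{p,ℚ}` in the cell memos (PROOF-gz2 Thm. 2: defect
`3,4,6`; PROOF-gz Thm. 1 + `TameBranchOfTwistBranch*`: defect `2` and (M)) — Disegni 2017 Thm. B at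
`(E, 𝟙_K)` resp. `(E♭, ε_K)`, Tunnell–Saito multiplicity one, uniform Gauss sums on a ramified
branch; NOT asserted here. A predicate on `(W, p, Dh)`; wrong tuples `(ε, α)` are vacuous rows.
[cite: Delbourgo1998, Thm. 1 and §2.5 BS-D(p) (ii) (pp. 151–152) (shape only; nothing asserted)]
[cite: Disegni2017, Thm. B (provenance of the rank-one clause; nothing asserted)]
[cite: MazurTateTeitelbaum1986Invent, §I.10, §I.13–I.14 (shape)] -/
@[conjecture] def TameBranchPAdicGrossZagierAt (W : WeierstrassCurve ℚ) [W.IsElliptic] [W.IsGloballyMinimal]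
    (p : ℕ) [Fact p.Prime] (Dh : PAdicHeightData W p) : Prop :=
  ∀ {N : ℕ} [NeZero N] {f : CuspForm (Gamma0 N) 2} (ε : DirichletCharacter ℂ_[p] p) (α : ℚ_[p])
    (B : PowerSeries ℚ_[p]),
    IsNewformOf W f → orderOf ε = tameDefect W p → ‖α‖ = 1 → IsTameBranchOf f p ε α B →
    ∀ (ϖ : ℚ), (ϖ : ℝ) * W.realPeriodRat = plusPeriod f →
      ∃ (u : ℤ_[p]ˣ) (q : ℚ),
        W.leadingLCoeff = (q : ℂ) * (W.realPeriodRat : ℂ) * (W.regulator : ℂ) ∧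
        ((ϖ : ℚ) : ℚ_[p]) * PowerSeries.coeff W.mordellWeilRank B *
            padicLog p (cyclotomicGenerator p) ^ W.mordellWeilRank =
          ((u : ℤ_[p]) : ℚ_[p]) * (q : ℚ_[p]) * padicRegulator Dh

variable (W : WeierstrassCurve ℚ) [W.IsElliptic] [W.IsGloballyMinimal] (p : ℕ) [hp : Fact p.Prime]

/-! ### §1 Rank 0: the typed input is a THEOREM (`B(0) = α⁻¹[0]⁺_f`, `[0]⁺_f·Ω⁺_f = L(E,1)`) -/

/-- **Rank 0: `TameBranchPAdicGrossZagierAt W p Dh` HOLDS, for every height datum** (any `p`, any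
tuple): `ϖ·B(0) = ϖ·α⁻¹·[0]⁺_f` (`IsTameBranchOf.constantCoeff`) and `L(E,1) = [0]⁺_f·Ω⁺_f = (ϖ·[0]⁺_f)·Ω_E`
(`IsNewformOf.entireLFunction_one_eq`), so with `Reg_∞ = Reg_p = 1` the identity holds with
`u = α⁻¹ ∈ ℤ_p^×`, `q = ϖ·[0]⁺_f`. [cite: MazurTateTeitelbaum1986Invent, §I.8 (8.6)] -/
theorem tameBranchPAdicGrossZagierAt_of_analyticRank_eq_zero
    (hGZK : rank_eq_analyticRank_of_analyticRank_le_one) (hr : W.analyticRank = 0)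
    (Dh : PAdicHeightData W p) : TameBranchPAdicGrossZagierAt W p Dh := by
  intro N _ f ε α B hf _hε hα hB ϖ hϖ
  -- rank 0 bookkeeping
  obtain ⟨hmw, -⟩ := hGZK W (by rw [hr]; exact zero_le_one)
  have hmw0 : W.mordellWeilRank = 0 := by rw [hmw, hr]
  haveI : Finite W.toAffine.Point := W.finite_point_of_rank_zero hmw0
  have hRegp : padicRegulator Dh = 1 := padicRegulator_eq_one_of_finite W p Dh
  have hReg : W.regulator = 1 := W.regulator_eq_one_of_rank_zero hmw0
  have hlead : W.leadingLCoeff = W.entireLFunction 1 := W.leadingLCoeff_eq_of_analyticRank_eq_zero hr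
  -- `L(E,1) = [0]⁺_f · Ω⁺_f = (ϖ [0]⁺_f) · Ω_E`
  have hL : W.entireLFunction 1 = ((ϖ * ratPlusSymbol f 0 : ℚ) : ℂ) * (W.realPeriodRat : ℂ) := by
    rw [hf.entireLFunction_one_eq, ← hϖ]
    push_cast
    ring
  -- the unit `u = α⁻¹`
  have hαval : ((PadicInt.mkUnits hα : ℤ_[p]) : ℚ_[p]) = α := PadicInt.mkUnits_eq hα
  have hα0 : α ≠ 0 := by rw [← hαval]; exact coe_units_ne_zero p _
  have hαinv : ((((PadicInt.mkUnits hα)⁻¹ : ℤ_[p]ˣ) : ℤ_[p]) : ℚ_[p]) = α⁻¹ := by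
    have h2 : (((PadicInt.mkUnits hα)⁻¹ : ℤ_[p]ˣ) : ℤ_[p]) * (PadicInt.mkUnits hα : ℤ_[p]) = 1 :=
      (PadicInt.mkUnits hα).inv_mul
    have h : ((((PadicInt.mkUnits hα)⁻¹ : ℤ_[p]ˣ) : ℤ_[p]) : ℚ_[p]) * α = 1 := by
      have h3 := congrArg ((↑) : ℤ_[p] → ℚ_[p]) h2
      rw [PadicInt.coe_mul, hαval, PadicInt.coe_one] at h3
      exact h3
    exact eq_inv_of_mul_eq_one_left h
  refine ⟨(PadicInt.mkUnits hα)⁻¹, ϖ * ratPlusSymbol f 0, ?_, ?_⟩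
  · rw [hlead, hL, hReg]
    push_cast
    ring
  · rw [hmw0, pow_zero, mul_one, PowerSeries.coeff_zero_eq_constantCoeff, hB.constantCoeff, hRegp,
      mul_one, hαinv]
    push_cast
    ring

/-! ### §2 Rank 1: the `T¹`-dictionary and the LOWER half from print + one number -/

variable {W} {p}

/-- **The `T¹`-dictionary under the typed tame-branch `p`-adic Gross–Zagier formula.** For `W`
globally minimal with `rank_ℤ E(ℚ) = 1`, a height datum `Dh` with `TameBranchPAdicGrossZagierAt W p Dh`,
a tame-branch tuple `(f, ε, α, B)` and a period index `ϖ` (`ϖ·Ω_E = Ω⁺_f`), IF `[T¹]B ≠ 0` then with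
`#Ш_an(E) = s ∈ ℚ`: `Reg_p(E,Dh) ≠ 0` (Schneider for `Dh`) and
**`ord_p ϖ + v_p([T¹]B) + 1 + 2·ord_p #E(ℚ)_tors = ord_p s + ord_p ∏c_ℓ + ord_p Reg_p(E,Dh)`**
(`#Ш_an = (L′(E,1)/(Ω_E·Reg_∞))·#T²/∏c`, `v_p(log_p γ₀) = 1`; `p ≠ 2`). The typed formula is proved on
paper in PROOF-gz2 §3 / PROOF-gz §3, not asserted here.
[cite: Delbourgo1998, §2.5 BS-D(p) (ii) (pp. 151–152) (shape only)] [cite: Miller2011LMS, Def. 1.1] -/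
theorem valuation_coeff_one_tameBranch_eq_of_tameBranchPAdicGrossZagier (hp2 : p ≠ 2)
    (hr1 : W.mordellWeilRank = 1) {Dh : PAdicHeightData W p}
    (hGZ : TameBranchPAdicGrossZagierAt W p Dh)
    {N : ℕ} [NeZero N] {f : CuspForm (Gamma0 N) 2} {ε : DirichletCharacter ℂ_[p] p} {α : ℚ_[p]}
    {B : PowerSeries ℚ_[p]} (hf : IsNewformOf W f) (hε : orderOf ε = tameDefect W p) (hα : ‖α‖ = 1)
    (hB : IsTameBranchOf f p ε α B) (ϖ : ℚ) (hϖ : (ϖ : ℝ) * W.realPeriodRat = plusPeriod f)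
    (h1 : PowerSeries.coeff 1 B ≠ 0) {s : ℚ} (hs : shaAn W = (s : ℂ)) :
    padicRegulator Dh ≠ 0 ∧
      padicValRat p ϖ + (PowerSeries.coeff 1 B).valuation + 1 + 2 * padicValNat p W.torsionOrder =
        padicValRat p s + padicValNat p W.tamagawaProduct + (padicRegulator Dh).valuation := by
  have hpQ : (p : ℚ_[p]) ≠ 0 := Nat.cast_ne_zero.mpr hp.out.ne_zero
  have hT0 : (W.torsionOrder : ℚ) ≠ 0 := by exact_mod_cast W.torsionOrder_pos_holds.ne'
  have hc0 : (W.tamagawaProduct : ℚ) ≠ 0 := by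
    exact_mod_cast (W.tamagawaProduct_pos_holds : 0 < W.tamagawaProduct).ne'
  have hΩ : (W.realPeriodRat : ℂ) ≠ 0 := by exact_mod_cast W.realPeriodRat_pos_holds.ne'
  have hR : (W.regulator : ℂ) ≠ 0 := by exact_mod_cast W.regulator_pos'.ne'
  have hcC : (W.tamagawaProduct : ℂ) ≠ 0 := by
    exact_mod_cast (W.tamagawaProduct_pos_holds : 0 < W.tamagawaProduct).ne'
  have hϖ0 : ϖ ≠ 0 := X2.varpi_ne_zero_of_isNewformOf hf hϖ
  have hϖQ : ((ϖ : ℚ) : ℚ_[p]) ≠ 0 := by exact_mod_cast hϖ0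
  -- the typed formula at `r = 1`
  obtain ⟨u, q, hL, hGZ'⟩ := hGZ ε α B hf hε hα hB ϖ hϖ
  rw [hr1, pow_one] at hGZ'
  -- `s = q · #T² / ∏c`
  have hs' : s = q * (W.torsionOrder : ℚ) ^ 2 / (W.tamagawaProduct : ℚ) := by
    have e : shaAn W = ((q * (W.torsionOrder : ℚ) ^ 2 / (W.tamagawaProduct : ℚ) : ℚ) : ℂ) := by
      rw [shaAn_def, hL]
      push_cast
      field_simp
    exact_mod_cast hs.symm.trans e
  -- valuations
  obtain ⟨w, hw⟩ := exists_unit_padicLog_cyclotomicGenerator (p := p) hp2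
  have hlog0 : padicLog p (cyclotomicGenerator p : ℚ_[p]) ≠ 0 := by
    rw [hw]; exact mul_ne_zero hpQ (coe_units_ne_zero p w)
  have hlogv : (padicLog p (cyclotomicGenerator p : ℚ_[p])).valuation = 1 := by
    rw [hw, Padic.valuation_mul hpQ (coe_units_ne_zero p w), Padic.valuation_p,
      valuation_coe_units_eq_zero, add_zero]
  have hlhs0 : ((ϖ : ℚ) : ℚ_[p]) * PowerSeries.coeff 1 B * padicLog p (cyclotomicGenerator p) ≠ 0 :=
    mul_ne_zero (mul_ne_zero hϖQ h1) hlog0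
  rw [hGZ'] at hlhs0
  have hqR0 : (q : ℚ_[p]) * padicRegulator Dh ≠ 0 := by
    intro e; apply hlhs0; rw [mul_assoc, e, mul_zero]
  have hq0 : (q : ℚ_[p]) ≠ 0 := left_ne_zero_of_mul hqR0
  have hReg0 : padicRegulator Dh ≠ 0 := right_ne_zero_of_mul hqR0
  have hq0' : q ≠ 0 := by rintro rfl; exact hq0 Rat.cast_zero
  refine ⟨hReg0, ?_⟩
  have hval := congrArg Padic.valuation hGZ'
  rw [Padic.valuation_mul (mul_ne_zero hϖQ h1) hlog0, Padic.valuation_mul hϖQ h1, hlogv,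
    Padic.valuation_mul (mul_ne_zero (coe_units_ne_zero p u) hq0) hReg0,
    Padic.valuation_mul (coe_units_ne_zero p u) hq0, valuation_coe_units_eq_zero, zero_add,
    Padic.valuation_ratCast, Padic.valuation_ratCast] at hval
  rw [hs', padicValRat.div (mul_ne_zero hq0' (pow_ne_zero 2 hT0)) hc0,
    padicValRat.mul hq0' (pow_ne_zero 2 hT0), padicValRat.pow, padicValRat.of_nat, padicValRat.of_nat]
  push_cast
  linarith

/-- **The regulator certificate `hreg` DISCHARGED by the typed formula + one unit coefficient.** Same
setting; if `‖[T¹]B‖_p = 1` (the census's "`λ^{an} = 1`, `μ^{an} = 0`" one-number certificate) and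
`ord_p ϖ ≤ 0` (the period index `Ω⁺_f/Ω_E`: Manin constant / lattice index — `ord_p ϖ ∈ {0, −1}`-type
bookkeeping, computed per pair), then
`ord_p Reg_p(E,Dh) + ord_p #Ш_an + ord_p ∏c ≤ rank + 2·ord_p #E(ℚ)_tors` — verbatim the hypothesis
`hreg` of `missingLowerBoundAt_of_tameBranchRatDvdAt_of_cert_of_regulatorCertificate`.
[cite: Delbourgo1998, §2.5 BS-D(p) (ii) (shape only)] [cite: Miller2011LMS, Def. 1.1] -/
theorem regulatorCertificate_of_tameBranchPAdicGrossZagier (hp2 : p ≠ 2)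
    (hr1 : W.mordellWeilRank = 1) {Dh : PAdicHeightData W p}
    (hGZ : TameBranchPAdicGrossZagierAt W p Dh)
    {N : ℕ} [NeZero N] {f : CuspForm (Gamma0 N) 2} {ε : DirichletCharacter ℂ_[p] p} {α : ℚ_[p]}
    {B : PowerSeries ℚ_[p]} (hf : IsNewformOf W f) (hε : orderOf ε = tameDefect W p) (hα : ‖α‖ = 1)
    (hB : IsTameBranchOf f p ε α B) (ϖ : ℚ) (hϖ : (ϖ : ℝ) * W.realPeriodRat = plusPeriod f)
    (hunit : ‖PowerSeries.coeff 1 B‖ = 1) (hϖv : padicValRat p ϖ ≤ 0) {s : ℚ} (hs : shaAn W = (s : ℂ)) :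
    (padicRegulator Dh).valuation + padicValRat p s + padicValNat p W.tamagawaProduct ≤
      (W.mordellWeilRank : ℤ) + 2 * padicValNat p W.torsionOrder := by
  have h1 : PowerSeries.coeff 1 B ≠ 0 := by
    intro h; rw [h, norm_zero] at hunit; exact zero_ne_one hunit
  have hv1 : (PowerSeries.coeff 1 B).valuation = 0 := by
    have := Padic.norm_eq_zpow_neg_valuation h1
    rw [hunit] at this
    have h' : (p : ℝ) ^ (-(PowerSeries.coeff 1 B).valuation) = 1 := this.symm
    have hp1 : (1 : ℝ) < p := by exact_mod_cast hp.out.one_lt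
    have := zpow_right_injective₀ (zero_lt_one.trans hp1) hp1.ne' (h'.trans (zpow_zero _).symm)
    linarith
  obtain ⟨-, hdict⟩ := valuation_coeff_one_tameBranch_eq_of_tameBranchPAdicGrossZagier hp2 hr1 hGZ hf hε
    hα hB ϖ hϖ h1 hs
  rw [hv1] at hdict
  rw [hr1]
  push_cast at hdict ⊢
  linarith

/-- **HEADLINE, RANK ONE: THE LOWER HALF OF BSD_p ON THE POTENTIALLY-ORDINARY ADDITIVE LOCUS FROM
PRINT + THE TYPED TAME-BRANCH `p`-ADIC GROSS–ZAGIER FORMULA + ONE NUMBER** (cell-agnostic; every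
defect `e ∈ {2,3,4,6}`; NO image hypothesis, NO main conjecture). For `E = W` globally minimal, `p ≠ 2`
additive of type (M) or (G-ord), `r_an(E) = 1` (so `rank = 1` by GZK), non-anomalous: the typed Kato
half `TameBranchRatDvdAt W p` (= Delbourgo 2002 Thm. (C), discharged from the named fact in
`TameBranchKatoDivisibilityOfDelbourgo.lean`), a tame-branch tuple `(f, ε, α, B)` with `B` `p`-integral
and **`‖[T¹]B‖_p = 1`**, Delbourgo 2002 (B) for the height datum `Dh` (`hBcl`) and (A)-torsion (`hA`),
the typed formula `TameBranchPAdicGrossZagierAt W p Dh` (PROOF-gz2 Thm. 2 for Delbourgo's `⟨,⟩_{p,ℚ}`),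
the period index `ϖ` with `ord_p ϖ ≤ 0`, and `#Ш_an = s` ⟹ **`Typed.MissingLowerBoundAt W p`**
(`ord_p #Ш_an(E) ≤ ord_p #Ш(E)`). The regulator certificate of
`missingLowerBoundAt_of_tameBranchRatDvdAt_of_cert_of_regulatorCertificate` is DISCHARGED by the
formula. X3♯(G-ord)/X4♯(G-ord) stay CONSTRUCTION-SHAPED; nothing booked.
[cite: Delbourgo2002, Theorem (A), (B), (C) (p. 40)] [cite: Miller2011LMS, Def. 1.1] -/
theorem missingLowerBoundAt_rankOne_of_tameBranchRatDvdAt_of_tameBranchPAdicGrossZagier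
    (hT : TameBranchRatDvdAt W p)
    {N : ℕ} [NeZero N] {f : CuspForm (Gamma0 N) 2} {ε : DirichletCharacter ℂ_[p] p} {α : ℚ_[p]}
    {B : PowerSeries ℚ_[p]}
    (hp2 : p ≠ 2) (hadd : Addv W p) (hloc : PotMult W p ∨ TypeGOrd W p)
    (hf : IsNewformOf W f) (hε : orderOf ε = tameDefect W p) (hα : ‖α‖ = 1)
    (hB : IsTameBranchOf f p ε α B) (hint : ∀ j : ℕ, ‖PowerSeries.coeff j B‖ ≤ 1)
    (hunit : ‖PowerSeries.coeff 1 B‖ = 1)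
    (ϖ : ℚ) (hϖ : (ϖ : ℝ) * W.realPeriodRat = plusPeriod f) (hϖv : padicValRat p ϖ ≤ 0)
    {Dh : PAdicHeightData W p} (hBcl : LeadingTermClauses W p Dh)
    (hGZ : TameBranchPAdicGrossZagierAt W p Dh)
    (hA : ∀ (κ : ZpExtension ℚ p) (γ : Field.absoluteGaloisGroup ℚ),
      κ.IsCyclotomic → κ.IsTopGenerator γ → ∀ D : W.SelmerDualData κ γ, D.IsTorsion)
    (hGZK : rank_eq_analyticRank_of_analyticRank_le_one) (hr : W.analyticRank = 1)
    (hna : ReductionNonAnomalous W p) {s : ℚ} (hs : shaAn W = (s : ℂ)) :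
    MissingLowerBoundAt W p := by
  obtain ⟨hmw, -⟩ := hGZK W (by rw [hr])
  have hr1 : W.mordellWeilRank = 1 := by rw [hmw, hr]
  have hreg := regulatorCertificate_of_tameBranchPAdicGrossZagier hp2 hr1 hGZ hf hε hα hB ϖ hϖ hunit
    hϖv hs
  exact missingLowerBoundAt_of_tameBranchRatDvdAt_of_cert_of_regulatorCertificate hT hp2 hadd hloc hf
    hε hα hB hint ⟨1, by rw [hr1], hunit⟩ hBcl hA hGZK (by rw [hr]) hna hs hreg

/-! ### §3 (appended 2026-08-25) Referee record — REF-gz2: PASS with CONDITION GZ-H2 — and the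
Schneider dictionary `Reg_p(E,Dh) ≠ 0 ⟺ [T¹]B ≠ 0` under the typed formula

REFEREE RECORD (cell `bsd-addord`). The cross-family referee scored the memo behind the rank-one
clause of `TameBranchPAdicGrossZagierAt` at defect `3,4,6` (HOME/proof/PROOF-gz2.md, text of record
sha256 813e215bedde3df0…, archived read-only under HOME/frozen/): **REF-gz2: PASS — Theorem 2,
Corollary 2′ (Cor. 3′ as the declared READING), with CONDITION GZ-H2**
(`run/shared/lean/pub/bsd-addord/REF-gz2.md`, sha256 a313db0ef4818b3e…, 2026-08-25; independent
STEP-0 re-run kit j241302: `u₀ = +1` on seven rows incl. an anomalous, a CM and a `p = 13` row;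
negative controls unbounded). The defect-2 / (M) clause is **REF-gz: PASS with condition GZ-H**
(REF-gz.md; its Literature form is `Disegni2017.delbourgoDatum_rankOne_leadingTerms`, p402187).
§§0–2 above are byte-identical to the accepted filing p402159, whose docstrings say "referee word
pending"; this section is the follow-up LIFT required by GZ-H2 (S12 / p396793 pattern). Still NOT
asserted: §0 stays a bare `Prop`; nothing is booked; labels UNCHANGED.

CONDITION GZ-H2 (binding locator sentence, verbatim in substance). In PROOF-gz2 §3.3 (Lemma H′) the
identification of the `p`-adic height of Disegni, Compos. Math. 153 (2017) Thm. B at `(E, 𝟙_K)` with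
Delbourgo's `h_p = ⟨,⟩_{p,ℚ}` (J. Number Theory 95 (2002) p. 39, `K = F_e ⊂ ℚ(μ_p)` of degree
`e = tameDefect`) is ROUTED THROUGH the (n-exc)-CONDITIONAL printed sentence Disegni 2017 Rem. 1.3.2
(arXiv v3 PDF p. 9, L14–16: under (n-exc) the canonical height coincides with the Schneider/Nekovář
norm-adapted and Mazur–Tate heights) together with the absolute normalisation (4.1.7)
`ℓ_w := [F′:F]⁻¹ ℓ_v ∘ N_{F′_w/F_v}` (PDF p. 39; (4.1.6)–(4.1.10) are printed, so base change /
`F′`-independence needs no further warrant), with (n-exc) DISCHARGED because the unit character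
`α_p = ε̃·unr(a)` is RAMIFIED (PROOF-gz2 3.1 (iv); Def. 1.3.3: (n-exc) ⟺ `Z_w ≠ 0`); the ultimate
source of the coincidence sentence — J. Nekovář, Sém. Théor. Nombres Paris 1990–91 (1993) §§7–8, and
Mazur–Tate 1983 §4.4 — is NOT HELD on the hub (acq-10827 open), so the verification trail is Disegni
2017's printed statements (refereed corroboration at good ordinary: Iovita–Werner 2003 p. 2, Werner
1998 Thm. 2.1 (i): Schneider = Mazur–Tate). The memo's sign `u₀ = ±1` is determined numerically only;
every consumer in this file is sign-blind (`∃ u ∈ ℤ_p^×`). -/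

/-- **The Schneider dictionary under the typed formula** (PROOF-gz2 Cor. 3′ / PROOF-gz Cor. 3 in kernel
form; Delbourgo's BS-D(p) (i) ⟺ (ii)-shape): for `W` globally minimal with `L(E,s)` entire (`hmod`) and
`r_an(E) = 1` (so `rank_ℤ E(ℚ) = 1` by GZK and `L′(E,1) ≠ 0`), a height datum `Dh` with
`TameBranchPAdicGrossZagierAt W p Dh`, ANY tame-branch tuple `(f, ε, α, B)` and its period index `ϖ`
(`p ≠ 2`): **`Reg_p(E,Dh) ≠ 0` (Schneider for `Dh`) iff `[T¹]B ≠ 0`** (the branch has a SIMPLE zero) —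
since `ϖ ≠ 0`, `log_p γ₀ ≠ 0`, `u ∈ ℤ_p^×` and `q = L′(E,1)/(Ω_E Reg_∞) ≠ 0` in
`ϖ·[T¹]B·log_p γ₀ = u·q·Reg_p(E,Dh)`. For Delbourgo's `⟨,⟩_{p,ℚ}` the left side is Schneider's
conjecture at the pair; the right side is a computable analytic certificate. CONDITION GZ-H2 of the
module docstring §3 applies to the height identification behind the rank-one clause.
[cite: Delbourgo1998, §2.5 BS-D(p) (i), (ii) (pp. 151–152)]
[cite: Disegni2017, Rem. 1.3.2 and §4.1 (4.1.7) (GZ-H2 locator; provenance of the clause, nothing asserted)] -/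
theorem schneiderConjecture_iff_coeff_one_ne_zero_of_tameBranchPAdicGrossZagier (hp2 : p ≠ 2)
    (hmod : hasEntireLFunction_rat) (hGZK : rank_eq_analyticRank_of_analyticRank_le_one)
    (hr : W.analyticRank = 1) {Dh : PAdicHeightData W p} (hGZ : TameBranchPAdicGrossZagierAt W p Dh)
    {N : ℕ} [NeZero N] {f : CuspForm (Gamma0 N) 2} {ε : DirichletCharacter ℂ_[p] p} {α : ℚ_[p]}
    {B : PowerSeries ℚ_[p]} (hf : IsNewformOf W f) (hε : orderOf ε = tameDefect W p) (hα : ‖α‖ = 1)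
    (hB : IsTameBranchOf f p ε α B) (ϖ : ℚ) (hϖ : (ϖ : ℝ) * W.realPeriodRat = plusPeriod f) :
    SchneiderConjecture Dh ↔ PowerSeries.coeff 1 B ≠ 0 := by
  obtain ⟨hmw, -⟩ := hGZK W (by rw [hr])
  have hr1 : W.mordellWeilRank = 1 := by rw [hmw, hr]
  have hpQ : (p : ℚ_[p]) ≠ 0 := Nat.cast_ne_zero.mpr hp.out.ne_zero
  have hϖQ : ((ϖ : ℚ) : ℚ_[p]) ≠ 0 := by exact_mod_cast X2.varpi_ne_zero_of_isNewformOf hf hϖ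
  obtain ⟨w, hw⟩ := exists_unit_padicLog_cyclotomicGenerator (p := p) hp2
  have hlog0 : padicLog p (cyclotomicGenerator p : ℚ_[p]) ≠ 0 := by
    rw [hw]; exact mul_ne_zero hpQ (coe_units_ne_zero p w)
  obtain ⟨u, q, hL, hGZ'⟩ := hGZ ε α B hf hε hα hB ϖ hϖ
  rw [hr1, pow_one] at hGZ'
  have hq : (q : ℚ_[p]) ≠ 0 := by
    have hq' : q ≠ 0 := by
      rintro rfl
      rw [Rat.cast_zero, zero_mul, zero_mul] at hL
      exact W.leadingLCoeff_ne_zero_holds (hmod W) hL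
    exact_mod_cast hq'
  rw [SchneiderConjecture]
  refine ⟨fun hReg h1 ↦ ?_, fun h1 hReg ↦ ?_⟩
  · have h0 : ((ϖ : ℚ) : ℚ_[p]) * PowerSeries.coeff 1 B * padicLog p (cyclotomicGenerator p) = 0 := by
      rw [h1, mul_zero, zero_mul]
    rw [hGZ'] at h0
    exact mul_ne_zero (mul_ne_zero (coe_units_ne_zero p u) hq) hReg h0
  · have h0 : ((ϖ : ℚ) : ℚ_[p]) * PowerSeries.coeff 1 B * padicLog p (cyclotomicGenerator p) ≠ 0 :=
      mul_ne_zero (mul_ne_zero hϖQ h1) hlog0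
    rw [hGZ', hReg, mul_zero] at h0
    exact h0 rfl

end Summit.BirchSwinnertonDyer.Rank1Residual.Additive
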